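import Literature.MathematicalPhysics.QuantumFieldTheory.Balaban1983to89.T4LinearSizeSharpLower

/-!
# T4HistoryLipschitzRescaling — Bałaban's RESCALING INEQUALITY [II] (2.36) `2d_k(Z_i) ≥ L·d_{k+1}(Z′_i)` in the
# kernel (lattice-edge form): PROVED for every block size `L ≥ 4` — hence throughout print's standing range «L is an
# odd, positive integer > 11» — with the SHARPER constant `(L − 2)·d_{k+1}(Z′) ≤ d_k(Z)`, by a SHIFT-AVERAGING
# argument; the boundary value `L = 3` is a kernel counterexample to the printed form

Scope (honest framing).  Finite, flat-lattice (`ℤ^ν`), two-scale geometry of cube families; every `theorem` below is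
kernel-proved from the definitions of `T4HistoryLipschitzLinearSize` (lattice-edge linear size `linSize`, skeletons) and
of §2 here.  No step of the manuscripts under audit is used as a hypothesis; the printed sentences are quoted only to TYPE
the statements (`[cite: …]` tags locate the printed shape, `[folklore]` marks elementary lemmas).  Nothing here is an
infinite-volume, continuum, mass-gap or Clay-problem statement.  (2.36) is the PER-STEP RESCALING of the linear size in
the inductive step `k → k+1` of [II] §2 — the factor by which a decay rate in the scale-`k` size of a domain becomes a
decay rate in the scale-`(k+1)` size of the domain it generates ((2.35) → (2.37) → (2.38) → (2.41)).  Precisely (p.19–20):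
from each factor `exp(−(1 − 5δ)κd_k(Z_i))` of (2.35) print first EXTRACTS `exp(−δκd_k(Z_i))` and spends it on the sum over
components («The last sum is estimated using (1.28), with κ replaced by δκ»); (2.36) is applied to the REMAINING rate
`a = (1 − 6δ)κ`, p.20 «and (1 − 5δ)κd_k(Z_i) in the exponentials replaced by (1 − 6δ)½Lκd_{k+1}(Z′_i)».  In the kernel the
rate `a` is arbitrary (`0 ≤ a`): `a` at scale `k` ↦ `a(L − 2n)` at scale `k+1` (`exp_neg_mul_linSize_le_exp_coarsen`), `≥ ½La`
(print) for `L ≥ 4`; in the NE9 / fading-memory chain of this package (`T4HistoryLipschitzRecursion` …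
`T4HistoryLipschitzLinearSize`) it is the geometric input that makes the per-step memory factor explicit.

TYPE (verbatim).  [I] p.251: «We take L_μ = L^m, where L is an odd, positive integer > 11, and m is a positive integer.
These spaces are divided into regular lattices of cubes with corners at points of L⁻ⁿZ^d, n = 0, 1, ....»  [I] p.257:
«For a cube □ ∈ π_j and n = 1, 2, ... we define □̃ⁿ as a cube of the size (1 + 2n)M and with a center at the center of
□.» «The meaning of the symbol X̃ⁿ should be obvious.» «Domains from different classes, i.e. classes corresponding to
different indices j, are connected by scaling transformations.» (linear size: «there are also the shortest tree graphs
formed by edges of cubes in X, hence an equivalent definition can be formulated, based on such graphs only» — the form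
formalised as `linSize`.)  [II] p.19: «The set Z₀ determining it is a union of connected components, Z₀ = ∪_i Z_i, and
we denote by Z′_i the smallest localization domain from 𝐃_{k+1} containing Z̃_i. … We extract exp(−δκd_k(Z_i)) from each
exponential in (2.35), corresponding to one of these components. The remaining exponential is bounded using the
following inequality: 2d_k(Z_i) ≥ Ld_{k+1}(Z′_i). (2.36) This inequality can be obtained by simple, but awkward,
geometric and combinatoric considerations. It follows by considering locally many possible cases.»  [II] p.20: «and
(1 − 5δ)κd_k(Z_i) in the exponentials replaced by (1 − 6δ)½Lκd_{k+1}(Z′_i)»; (2.38) «|H(Z)| ≤ C₃ε₁exp(−(1 − 8δ)½Lκ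
d_{k+1}(Z))»; p.21: «At first we assume that (1 − 10δ)½L = 1, or δ = (1/10)(1 − 2L⁻¹).»

Model (§2).  Cubes of scale `k` are unit cubes of `ℤ^ν` named by their lower corners (as in
`T4HistoryLipschitzLinearSize`); `thicken n X = X̃ⁿ` = all cubes `□ + δ`, `□ ∈ X`, `δ ∈ [−n, n]^ν` (`X̃ = X̃¹`); the cubes
of scale `k+1` are the blocks `L·β + [0, L)^ν`, `β ∈ ℤ^ν` (the `M`-lattice refines the `LM`-lattice since both are powers
of `L`, [I] p.251), `blockOf L □ = ⌊□/L⌋` and `coarsen L Y` = the family of blocks meeting `Y`, a cube family of the index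
lattice — one scale up blocks are unit cubes again, so `linSize (coarsen L Y)` is `d_{k+1}`.  For a wall-connected `Z`
the block family of `Z̃ⁿ` is wall-connected (`isConn_coarsen_thicken`, §6), so it is exactly print's `Z′_i` («the smallest
localization domain from 𝐃_{k+1} containing Z̃_i»).

Results (all kernel-checked, no `sorry`, axioms `propext`, `Classical.choice`, `Quot.sound` only).
* §4 `sub_mul_linSize_coarsen_thicken_le`: for every cube family `X ⊆ ℤ^ν` with a skeleton, every `n` and every
  `L ≥ 2n + 1`, `(L − 2n) · d(coarsen L X̃ⁿ) ≤ d(X)`.  PROOF (not print's «many possible cases»; a global averaging): take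
  an optimal skeleton `S` (`#S = d(X) + 1`); for EVERY shift `s ∈ [n, L−1−n]^ν` the shifted rounding `p ↦ ⌊(p+s)/L⌋` maps
  `S` onto a skeleton of the block family (§3: a corner of `□` rounds to a corner of the block of `□ + δ`,
  `isCorner_blockOf_roundShift`; a cube edge rounds to a point or to an edge of a block of the family,
  `roundShift_edgeAdj`; images of connected sets, `isConn_image`); and a unit lattice step is rounded to two different
  points by at most a `1/(L − 2n)` fraction of the shifts (`mul_card_filter_le_of_edgeAdj`: the `i`-th shift coordinate is
  pinned), so ON AVERAGE the image has `≤ 1 + (#S − 1)/(L − 2n)` points (`mul_sum_card_image_sdiff_le`, a strong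
  induction over the components of `S ∖ {root}` mirroring `T4LinearSizeSharpLower.card_biUnion_sdiff_le`, and the
  pigeonhole `exists_mul_card_image_sub_one_le`).
* §4 `printed236_of_four_le` / `printed236_of_eleven_lt` / `printedIneq236_of_four_le` / §6 `printed236_of_isConn`:
  the printed `L·d_{k+1}(Z′) ≤ 2·d_k(Z)` for EVERY `L ≥ 4` (so for every odd `L > 11`), from `(L−2)d′ ≤ d` and
  `2d′ ≤ (L−2)d′`; `mul_linSize_coarsen_le` (`n = 0`: `L·d(blocks of X) ≤ d(X)`); `linSize_coarsen_thicken_eq_zero`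
  (`d(X) < L − 2n ⟹ d′ = 0`); the exponential (fading-memory) forms `exp_neg_mul_linSize_le_exp_coarsen` (rate `a` at
  scale `k` ⟹ rate `a(L − 2n)` at scale `k+1`) and `exp_neg_mul_linSize_le_exp_half` (print's rate `½La`, `L ≥ 4`).
  REMARK (ours, not print's): the kernel constant `1/(L−2)` improves print's `2/L` for `L > 4`; print's bookkeeping
  `(1 − 10δ)½L = 1` (p.21) only needs `2/L`.
* §5 THE RANGE IS SHARP AT THE BOTTOM: for `L = 3` and the three aligned cubes `line3 = {0, e₀, 2e₀} ⊆ ℤ⁴`,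
  `d = 1` and `d′ = d(coarsen 3 line3~) = 1` (`linSize_line3_and_coarsen`; the blocks of index `−e₀ ∋ −e₀` and `e₀ ∋ 3e₀`
  have no common corner), so `L·d′ = 3 > 2 = 2d` (`not_printedIneq236_three`, `not_printedIneq236_four_three`) while the
  sharper `(L−2)d′ ≤ d` is attained.  `L = 3` lies OUTSIDE print's standing assumption `L > 11` ([I] p.251): this is a
  boundary marker for the kernel range `L ≥ 4`, not an objection to [II].
* §6 connectivity: `X̃ⁿ` and block families of wall-connected families are wall-connected (`isConn_thicken`,
  `isConn_coarsen`, `isConn_coarsen_thicken`), identifying `coarsen L (thicken 1 Z)` with print's `Z′`.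

Related kernel results in the tree (OTHER READING of `d_k`; recorded for orientation, nothing of them is used or restated
here).  For the SUP-METRIC CONTINUUM tree length `treeLen` of `…Balaban1983to89.TreeLength` ([I] p.257 first formulation,
the convention of [Dimock2013BalabanII] App. E; cell divergence D-T2) the B13 sub-cell proved (2.36)-type transfer
inequalities earlier and by a different route (rescaled admissible graph + whiskers at a separated net, resp. at a centre
net of a cut spanning tree): `B13Geometry236.geometry236_treeLen` (`L·d′ ≤ (3 + 4/(L−2))·d`, every `L ≥ 3`),
`B13Geometry236Printed.geometry236_printed` (the PRINTED factor, `L·d′ ≤ 2d`, every `L ≥ 8`, through `3/2 + 3/(L−2)`), their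
torus versions `TreeLengthTorusTransfer` / `TreeLengthTorusGeometry236` / `TreeLengthTorusGeometry236Printed`
(`torusTreeLen`, `B13.Ineq236Printed (tsys d (L·N′)) (tsys d N′) … L` for `L ≥ 8`), and the substitute with explicit constants
from quoted leaves `B13ScaleTransfer` (which also types `Ineq236Printed`); cell rows G-B13-09 / G-B13-09R / C-B13-09 /
C-pv11g2-1 / C-adv4-59 / C-pv22g3-1/2.  The present module is the LATTICE-EDGE reading ([I] p.257 second formulation) with
the shift-averaging proof, constant `1/(L−2)` and range `L ≥ 4` for the printed factor; the two readings of `d_k` are not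
termwise comparable (D-T2), so neither result implies the other.

Not claimed.  (i) Print's `d_k` is the continuum Steiner length ([I] p.257 «we consider graphs in the continuous
space»), asserted there to have an equivalent lattice-edge formulation; all statements here concern the lattice-edge
`linSize` (the two are not literally equal in general — see the header of `T4HistoryLipschitzLinearSize`).  (ii) The
torus `T_η` (identifications modulo `L_μ = L^m`) is not treated: the statements are on the flat lattice `ℤ^ν`, where
print's local argument also lives.  (iii) Print's own route («considering locally many possible cases») is not
reconstructed; the kernel proof is a different, global one.

References: [Balaban1987RG1] T. Bałaban, Renormalization group approach to lattice gauge field theories. I, Comm.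
Math. Phys. 109 (1987) 249–301: p.251 (the integer `L`, nested cube lattices), p.257 (`□̃ⁿ`, `X̃ⁿ`, localization
domains, scaling between classes `𝐃_j`, linear size); [Balaban1988RG2Cluster] part II, Comm. Math. Phys. 116 (1988)
1–22: (2.35)–(2.36) and the `Z′_i` sentence p.19, (2.37)–(2.38) p.20, (2.41) and the choice of `δ` p.21.

v1 (gen 12 of the NE9-P2 lineage; census item T32 of `t4/T4-EST-NE9-P2.md`).  Imports `T4LinearSizeSharpLower` (reader
seat pv12-g19's leaf, for `exists_adj_isConn_of_mem_comps`; it re-exports `T4HistoryLipschitzLinearSize`).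
v1.0.1 (gen 13; DOCSTRINGS ONLY, every declaration byte-identical to v1): cross-read C-ne5p1-18 D1 (the docstrings of
`printed236_of_four_le` / `exp_neg_mul_linSize_le_exp_coarsen` now quote [II] p.19 verbatim instead of a stitched
paraphrase inside guillemets; = citation-police finding P-t4lit1g6-3), D2 (the rate gloss above: (2.36) rescales the
REMAINING rate after the extraction of `exp(−δκd_k(Z_i))`), I1 (subscript `Z′_i` / `Z̃_i`); the «Related kernel results»
paragraph (the B13 sub-cell's sup-metric certificates, which v1's records had not cross-referenced).
-/

noncomputable section

namespace Literature.MathematicalPhysics.QuantumFieldTheory.Balaban1983to89.T4HistoryLipschitzRescaling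

open scoped BigOperators
open Literature.MathematicalPhysics.QuantumFieldTheory
open Literature.MathematicalPhysics.QuantumFieldTheory.Balaban1983to89.T4HistoryLipschitzLinearSize
open Literature.MathematicalPhysics.QuantumFieldTheory.Balaban1983to89.T4LinearSizeSharpLower (exists_adj_isConn_of_mem_comps)

/-! ## §0 Integer floor division by the block size: one step moves the block index by `0` or `1` -/

section IntDiv

/-- **one lattice step changes a block index by `0` or by `1`, the latter exactly when a block boundary is crossed**:
for `0 < L`, either `(x+1)/L = x/L` and `L ∤ x+1`, or `(x+1)/L = x/L + 1` and `L ∣ x+1` (floor division). [folklore] -/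
theorem ediv_add_one_cases {L : ℤ} (hL : 0 < L) (x : ℤ) :
    ((x + 1) / L = x / L ∧ ¬ L ∣ x + 1) ∨ ((x + 1) / L = x / L + 1 ∧ L ∣ x + 1) := by
  have h0 : L ≠ 0 := hL.ne'
  have hdec : x % L + L * (x / L) = x := Int.emod_add_mul_ediv x L
  have hnn : 0 ≤ x % L := Int.emod_nonneg x h0
  have hlt : x % L < L := Int.emod_lt_of_pos x hL
  by_cases h : x % L + 1 = L
  · right
    have hx : x + 1 = L * (x / L + 1) := by rw [mul_add, mul_one]; omega
    refine ⟨?_, ⟨x / L + 1, hx⟩⟩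
    rw [hx, Int.mul_ediv_cancel_left _ h0]
  · left
    have hlt' : x % L + 1 < L := lt_of_le_of_ne (by omega) h
    have hx : x + 1 = (x % L + 1) + L * (x / L) := by omega
    refine ⟨?_, ?_⟩
    · rw [hx, Int.add_mul_ediv_left _ _ h0, Int.ediv_eq_zero_of_lt (by omega) hlt', zero_add]
    · rintro ⟨m, hm⟩
      have hk : L * (m - x / L) = x % L + 1 := by rw [mul_sub]; omega
      rcases le_or_gt (m - x / L) 0 with h' | h'
      · have := mul_le_mul_of_nonneg_left h' hL.le
        omega
      · have h'' : (1 : ℤ) ≤ m - x / L := h'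
        have := mul_le_mul_of_nonneg_left h'' hL.le
        omega

end IntDiv

/-! ## §1 Two generic lemmas on rooted connectivity: images, and the SHIFT-AVERAGED image count -/

section Generic

variable {α β : Type*}

/-- **the image of a connected set under a map sending adjacent points to equal or adjacent points is connected**
(rooted reachability `Polymer.IsConn`). [folklore] -/
theorem isConn_image [DecidableEq β] {adj : α → α → Prop} {adj' : β → β → Prop} {S : Finset α} {a : α} (f : α → β)
    (hf : ∀ x ∈ S, ∀ y ∈ S, adj x y → f x = f y ∨ adj' (f x) (f y)) (h : Polymer.IsConn adj S a) :
    Polymer.IsConn adj' (S.image f) (f a) := by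
  refine ⟨Finset.mem_image_of_mem f h.1, fun b' hb' => ?_⟩
  obtain ⟨b, hb, rfl⟩ := Finset.mem_image.1 hb'
  have hr := h.2 b hb
  clear hb hb'
  induction hr with
  | refl => exact Polymer.Reach.refl _
  | @tail u v _ huv ih =>
    obtain ⟨hu, hv, hadj⟩ := huv
    rcases hf u hu v hv hadj with heq | hadj'
    · rw [← heq]; exact ih
    · exact ih.tail (Finset.mem_image_of_mem f hu) (Finset.mem_image_of_mem f hv) hadj'

/-- **SHIFT-AVERAGED IMAGE COUNT.**  A finite family of maps `g s : α → β` indexed by «shifts» `s ∈ T`, and a set `S`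
connected from `a`.  If along every step `adj c r` the shifts under which `c` and `r` have DIFFERENT images are few —
`W · #{s ∈ T | g s c ≠ g s r} ≤ #T` — then, summed over all shifts, the images have few points besides the image of the
root: `W · Σ_{s∈T} #(g s '' S ∖ {g s a}) ≤ #T · (#S − 1)`.  (Strong induction on `S`: split `S ∖ {a}` into its components
`K`, each containing a neighbour `t` of `a`; `g s '' K ∖ {g s a}` has at most `#(g s '' K ∖ {g s t}) + [g s a ≠ g s t]`
points; sum over `s` and use the hypothesis on the step `adj a t` and induction from `t`.)  [folklore] -/
theorem mul_sum_card_image_sdiff_le {σ : Type*} [DecidableEq α] [DecidableEq β] {adj : α → α → Prop} [Std.Symm adj]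
    (T : Finset σ) (g : σ → α → β) {W : ℕ}
    (hW : ∀ c r, adj c r → W * (T.filter fun s => g s c ≠ g s r).card ≤ T.card) :
    ∀ (S : Finset α) (a : α), Polymer.IsConn adj S a →
      W * ∑ s ∈ T, (S.image (g s) \ {g s a}).card ≤ T.card * (S.card - 1) := by
  intro S
  induction S using Finset.strongInduction with
  | H S ih =>
  intro a hS
  set Q := S.erase a with hQ
  have hcov : ∀ b ∈ Q, ∃ t ∈ Q, Polymer.Reach adj Q t b := fun b hb => ⟨b, hb, Polymer.Reach.refl b⟩
  have hsub : ∀ s, S.image (g s) \ {g s a} ⊆ (Polymer.comps adj Q Q).biUnion fun K => K.image (g s) \ {g s a} := by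
    intro s x hx
    rw [Finset.mem_sdiff, Finset.mem_image] at hx
    obtain ⟨⟨c, hcS, rfl⟩, hxa⟩ := hx
    have hca : c ≠ a := by rintro rfl; exact hxa (Finset.mem_singleton_self _)
    have hcQ : c ∈ Q := Finset.mem_erase.2 ⟨hca, hcS⟩
    refine Finset.mem_biUnion.2 ⟨Polymer.comp adj Q c, Polymer.mem_comps.2 ⟨c, hcQ, rfl⟩, ?_⟩
    exact Finset.mem_sdiff.2 ⟨Finset.mem_image_of_mem _ (Polymer.mem_comp_self.2 hcQ), hxa⟩
  have hK : ∀ K ∈ Polymer.comps adj Q Q, W * ∑ s ∈ T, (K.image (g s) \ {g s a}).card ≤ T.card * K.card := by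
    intro K hK
    obtain ⟨t, htK, hat, hKt⟩ := exists_adj_isConn_of_mem_comps hS hK
    have hKQ : K ⊆ Q := Polymer.subset_of_mem_comps hK
    have hKS : K ⊂ S := by
      refine Finset.ssubset_iff_subset_ne.2 ⟨hKQ.trans (Finset.erase_subset a S), ?_⟩
      rintro rfl
      exact (Finset.mem_erase.1 (hKQ hS.mem)).1 rfl
    have ih' := ih K hKS t hKt
    have hstep : ∀ s, (K.image (g s) \ {g s a}).card ≤
        (K.image (g s) \ {g s t}).card + (if g s a ≠ g s t then 1 else 0) := by
      intro s
      by_cases h : g s a = g s t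
      · rw [h]; simp
      · rw [if_pos h]
        have ht : {g s t} ⊆ K.image (g s) := Finset.singleton_subset_iff.2 (Finset.mem_image_of_mem _ htK)
        rw [Finset.card_sdiff_of_subset ht, Finset.card_singleton]
        have h1 := Finset.card_le_card (Finset.sdiff_subset : K.image (g s) \ {g s a} ⊆ K.image (g s))
        have hpos : 0 < (K.image (g s)).card := Finset.card_pos.2 ⟨_, Finset.mem_image_of_mem _ htK⟩
        omega
    have hsum : ∑ s ∈ T, (K.image (g s) \ {g s a}).card ≤
        ∑ s ∈ T, (K.image (g s) \ {g s t}).card + (T.filter fun s => g s a ≠ g s t).card := by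
      rw [Finset.card_filter, ← Finset.sum_add_distrib]
      exact Finset.sum_le_sum fun s _ => hstep s
    have hpos : 1 ≤ K.card := hKt.card_pos
    calc W * ∑ s ∈ T, (K.image (g s) \ {g s a}).card
        ≤ W * (∑ s ∈ T, (K.image (g s) \ {g s t}).card + (T.filter fun s => g s a ≠ g s t).card) :=
          Nat.mul_le_mul_left _ hsum
      _ = W * ∑ s ∈ T, (K.image (g s) \ {g s t}).card + W * (T.filter fun s => g s a ≠ g s t).card := Nat.mul_add _ _ _
      _ ≤ T.card * (K.card - 1) + T.card := Nat.add_le_add ih' (hW a t hat)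
      _ = T.card * K.card := by
        obtain ⟨k, hk⟩ : ∃ k, K.card = k + 1 := ⟨K.card - 1, by omega⟩
        rw [hk, Nat.add_sub_cancel]; ring
  calc W * ∑ s ∈ T, (S.image (g s) \ {g s a}).card
      ≤ W * ∑ s ∈ T, ∑ K ∈ Polymer.comps adj Q Q, (K.image (g s) \ {g s a}).card := by
        refine Nat.mul_le_mul_left _ (Finset.sum_le_sum fun s _ => ?_)
        exact (Finset.card_le_card (hsub s)).trans Finset.card_biUnion_le
    _ = ∑ K ∈ Polymer.comps adj Q Q, W * ∑ s ∈ T, (K.image (g s) \ {g s a}).card := by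
        rw [Finset.sum_comm, Finset.mul_sum]
    _ ≤ ∑ K ∈ Polymer.comps adj Q Q, T.card * K.card := Finset.sum_le_sum hK
    _ = T.card * Q.card := by rw [← Finset.mul_sum, ← Polymer.card_eq_sum_card_comps (subset_refl Q) hcov]
    _ = T.card * (S.card - 1) := by rw [hQ, Finset.card_erase_of_mem hS.mem]

/-- **PIGEONHOLE OVER SHIFTS**: under the hypothesis of `mul_sum_card_image_sdiff_le` and `T ≠ ∅`, SOME shift `s ∈ T`
has an image with `W · (#(g s '' S) − 1) ≤ #S − 1`. [folklore] -/
theorem exists_mul_card_image_sub_one_le {σ : Type*} [DecidableEq α] [DecidableEq β] {adj : α → α → Prop}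
    [Std.Symm adj] (T : Finset σ) (hT : T.Nonempty) (g : σ → α → β) {W : ℕ}
    (hW : ∀ c r, adj c r → W * (T.filter fun s => g s c ≠ g s r).card ≤ T.card)
    (S : Finset α) (a : α) (hS : Polymer.IsConn adj S a) :
    ∃ s ∈ T, W * ((S.image (g s)).card - 1) ≤ S.card - 1 := by
  have hmain := mul_sum_card_image_sdiff_le T g hW S a hS
  have heq : ∀ s, (S.image (g s)).card - 1 = (S.image (g s) \ {g s a}).card := fun s => by
    rw [Finset.card_sdiff_of_subset (Finset.singleton_subset_iff.2 (Finset.mem_image_of_mem _ hS.mem)),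
      Finset.card_singleton]
  apply Finset.exists_le_of_sum_le hT
  rw [Finset.sum_const, smul_eq_mul, ← Finset.mul_sum]
  simpa only [heq] using hmain

/-- two adjacent points form a set connected from the first. [folklore] -/
theorem isConn_pair_of_adj [DecidableEq α] {adj : α → α → Prop} {u v : α} (h : adj u v) :
    Polymer.IsConn adj ({u, v} : Finset α) u := by
  refine ⟨Finset.mem_insert_self _ _, fun b hb => ?_⟩
  rcases Finset.mem_insert.1 hb with rfl | hb
  · exact Polymer.Reach.refl _
  · rw [Finset.mem_singleton.1 hb]
    exact Polymer.Reach.single (Finset.mem_insert_self _ _) (Finset.mem_insert_of_mem (Finset.mem_singleton_self _)) h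

end Generic

/-! ## §2 Two scales of cubes on `ℤ^ν`: thickenings `X̃ⁿ`, blocks of side `L`, the block family `Z'`, shifted roundings -/

section TwoScale

variable {ν : ℕ}

/-- the offsets `δ ∈ [−n, n]^ν`: the `(1+2n)^ν` unit cubes `□ + δ` make up the cube `□̃ⁿ` of [I] p.257 «we define □̃ⁿ as a
cube of the size (1 + 2n)M and with a center at the center of □». [cite: Balaban1987RG1, p.257] -/
def offsets (ν n : ℕ) : Finset (Fin ν → ℤ) := Fintype.piFinset fun _ => Finset.Icc (-(n : ℤ)) n

/-- **THE THICKENING `X̃ⁿ = ∪_{□⊂X} □̃ⁿ`** of a cube family (lower corners): all cubes `□ + δ`, `□ ∈ X`, `δ ∈ [−n, n]^ν`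
([I] p.257 «The meaning of the symbol X̃ⁿ should be obvious»; `X̃ = X̃¹`). [cite: Balaban1987RG1, p.257] -/
def thicken (n : ℕ) (X : Finset (Fin ν → ℤ)) : Finset (Fin ν → ℤ) := (X ×ˢ offsets ν n).image fun q => q.1 + q.2

/-- **THE BLOCK OF A UNIT CUBE**: the cube of the next scale (side `L`, i.e. an `LM`-cube, lower corner in `Lℤ^ν` —
[I] p.251 «regular lattices of cubes with corners at points of L⁻ⁿZ^d, n = 0, 1, …») containing the unit cube `c`, recorded
by its index `⌊c/L⌋ ∈ ℤ^ν` (componentwise floor division). [cite: Balaban1987RG1, p.251] -/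
def blockOf (L : ℕ) (c : Fin ν → ℤ) : Fin ν → ℤ := fun i => c i / (L : ℤ)

/-- **THE BLOCK FAMILY** of a cube family `Y`: the blocks meeting `Y`, as a cube family of the index lattice `ℤ^ν` (one
scale up, blocks are unit cubes again: [I] p.257 «Domains from different classes … are connected by scaling
transformations»).  For `Y = Z̃` this is [II] p.19 «we denote by Z′_i the smallest localization domain from 𝐃_{k+1}
containing Z̃_i». [cite: Balaban1988RG2Cluster, p.19] -/
def coarsen (L : ℕ) (Y : Finset (Fin ν → ℤ)) : Finset (Fin ν → ℤ) := Y.image (blockOf L)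

/-- the admissible SHIFTS `s ∈ [n, L−1−n]^ν` of the rounding (there are `(L−2n)^ν` of them). [folklore] -/
def shifts (ν L n : ℕ) : Finset (Fin ν → ℤ) := Fintype.piFinset fun _ => Finset.Icc (n : ℤ) ((L : ℤ) - 1 - n)

/-- the SHIFTED ROUNDING of a lattice point to a block corner (index lattice): `p ↦ ⌊(p + s)/L⌋`. [folklore] -/
def roundShift (L : ℕ) (s p : Fin ν → ℤ) : Fin ν → ℤ := blockOf L (p + s)

/-- membership in `[−n, n]^ν`. [folklore] -/
theorem mem_offsets {n : ℕ} {δ : Fin ν → ℤ} : δ ∈ offsets ν n ↔ ∀ i, -(n : ℤ) ≤ δ i ∧ δ i ≤ n := by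
  simp [offsets, Fintype.mem_piFinset, Finset.mem_Icc]

/-- membership in `[n, L−1−n]^ν`. [folklore] -/
theorem mem_shifts {L n : ℕ} {s : Fin ν → ℤ} : s ∈ shifts ν L n ↔ ∀ i, (n : ℤ) ≤ s i ∧ s i ≤ (L : ℤ) - 1 - n := by
  simp [shifts, Fintype.mem_piFinset, Finset.mem_Icc]

/-- `0 ∈ [−n, n]^ν`: a cube belongs to its own thickening. [folklore] -/
theorem zero_mem_offsets (ν n : ℕ) : (0 : Fin ν → ℤ) ∈ offsets ν n :=
  mem_offsets.2 fun _ => ⟨by simp, by simp⟩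

/-- membership in `X̃ⁿ`: `y = □ + δ` with `□ ∈ X`, `δ ∈ [−n, n]^ν`. [folklore] -/
theorem mem_thicken {n : ℕ} {X : Finset (Fin ν → ℤ)} {y : Fin ν → ℤ} :
    y ∈ thicken n X ↔ ∃ c ∈ X, ∃ δ ∈ offsets ν n, c + δ = y := by
  simp only [thicken, Finset.mem_image, Finset.mem_product, Prod.exists]
  exact ⟨fun ⟨c, δ, ⟨hc, hδ⟩, h⟩ => ⟨c, hc, δ, hδ, h⟩, fun ⟨c, hc, δ, hδ, h⟩ => ⟨c, δ, ⟨hc, hδ⟩, h⟩⟩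

/-- `□ + δ ∈ X̃ⁿ` for `□ ∈ X`, `δ ∈ [−n, n]^ν`. [folklore] -/
theorem add_mem_thicken {n : ℕ} {X : Finset (Fin ν → ℤ)} {c δ : Fin ν → ℤ} (hc : c ∈ X) (hδ : δ ∈ offsets ν n) :
    c + δ ∈ thicken n X :=
  mem_thicken.2 ⟨c, hc, δ, hδ, rfl⟩

/-- `X ⊆ X̃ⁿ`. [folklore] -/
theorem self_mem_thicken {n : ℕ} {X : Finset (Fin ν → ℤ)} {c : Fin ν → ℤ} (hc : c ∈ X) : c ∈ thicken n X := by
  simpa using add_mem_thicken hc (zero_mem_offsets ν n)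

/-- the block of a cube of `Y` belongs to the block family of `Y`. [folklore] -/
theorem blockOf_mem_coarsen {L : ℕ} {Y : Finset (Fin ν → ℤ)} {y : Fin ν → ℤ} (hy : y ∈ Y) :
    blockOf L y ∈ coarsen L Y :=
  Finset.mem_image_of_mem _ hy

/-- the shifts are nonempty as soon as `L ≥ 2n + 1`. [folklore] -/
theorem shifts_nonempty {L n : ℕ} (hL : 2 * n + 1 ≤ L) : (shifts ν L n).Nonempty :=
  ⟨fun _ => (n : ℤ), mem_shifts.2 fun _ => ⟨le_rfl, by omega⟩⟩

end TwoScale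

/-! ## §3 A shifted rounding of a skeleton of `X` is a skeleton of the block family of `X̃ⁿ` -/

section Rounding

variable {ν : ℕ}

/-- **COVERING.**  For an admissible shift `s ∈ [n, L−1−n]^ν`, a corner `p` of a cube `□`, and `δ ∈ [−n, n]^ν`: the shifted
rounding `⌊(p+s)/L⌋` of `p` is a CORNER of the block of `□ + δ` (componentwise `⌊(□_j+δ_j)/L⌋ ≤ ⌊(p_j+s_j)/L⌋ ≤
⌊(□_j+δ_j)/L⌋ + 1`, from `δ_j ≤ n ≤ s_j` and `p_j + s_j ≤ □_j + 1 + (L−1−n) ≤ □_j + δ_j + L`).  So the roundings of a set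
meeting every cube of `X` at a corner meet every block of the block family of `X̃ⁿ` at a corner. [folklore] -/
theorem isCorner_blockOf_roundShift {L n : ℕ} (hL : 2 * n + 1 ≤ L) {s : Fin ν → ℤ} (hs : s ∈ shifts ν L n)
    {m p δ : Fin ν → ℤ} (hp : IsCorner m p) (hδ : δ ∈ offsets ν n) :
    IsCorner (blockOf L (m + δ)) (roundShift L s p) := by
  classical
  obtain ⟨ε, rfl⟩ := hp
  have hL0 : (0 : ℤ) < L := by exact_mod_cast (show 0 < L by omega)
  rw [mem_shifts] at hs
  rw [mem_offsets] at hδ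
  have key : ∀ j, blockOf L (m + δ) j ≤ roundShift L s (m + cornerVec ε) j ∧
      roundShift L s (m + cornerVec ε) j ≤ blockOf L (m + δ) j + 1 := by
    intro j
    have hcv : (cornerVec ε : Fin ν → ℤ) j = if j ∈ ε then 1 else 0 := rfl
    have hcv0 : 0 ≤ (cornerVec ε : Fin ν → ℤ) j ∧ (cornerVec ε : Fin ν → ℤ) j ≤ 1 := by
      rw [hcv]; split_ifs <;> simp
    obtain ⟨hs1, hs2⟩ := hs j
    obtain ⟨hd1, hd2⟩ := hδ j
    simp only [roundShift, blockOf, Pi.add_apply]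
    constructor
    · exact Int.ediv_le_ediv hL0 (by omega)
    · calc (m j + (cornerVec ε : Fin ν → ℤ) j + s j) / (L : ℤ) ≤ (m j + δ j + (L : ℤ) * 1) / (L : ℤ) :=
            Int.ediv_le_ediv hL0 (by omega)
        _ = (m j + δ j) / (L : ℤ) + 1 := Int.add_mul_ediv_left _ _ hL0.ne'
  refine ⟨Finset.univ.filter fun j => roundShift L s (m + cornerVec ε) j = blockOf L (m + δ) j + 1, ?_⟩
  funext j
  rw [Pi.add_apply, show (cornerVec (Finset.univ.filter fun j => roundShift L s (m + cornerVec ε) j =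
      blockOf L (m + δ) j + 1) : Fin ν → ℤ) j = if j ∈ (Finset.univ.filter fun j =>
      roundShift L s (m + cornerVec ε) j = blockOf L (m + δ) j + 1) then 1 else 0 from rfl]
  simp only [Finset.mem_filter, Finset.mem_univ, true_and]
  obtain ⟨h1, h2⟩ := key j
  split_ifs with h
  · exact h
  · omega

/-- **CUBE EDGES ROUND TO POINTS OR TO BLOCK EDGES.**  Along an edge `[c, c'] ` of a cube `□ ∈ X` the shifted roundings
either coincide or are the two endpoints of an edge of the block of `□` — a block of the block family of `X̃ⁿ` (indeed
of `X`): the rounding moves by `0` or `e_i` (`ediv_add_one_cases`), both roundings are corners of that block (COVERING with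
`δ = 0`), and a corner `q` with `q + e_i` again a corner has `i`-th coordinate the lower one. [folklore] -/
theorem roundShift_edgeAdj {X : Finset (Fin ν → ℤ)} {L n : ℕ} (hL : 2 * n + 1 ≤ L) {s : Fin ν → ℤ}
    (hs : s ∈ shifts ν L n) {c r : Fin ν → ℤ} (h : EdgeAdj X c r) :
    roundShift L s c = roundShift L s r ∨
      EdgeAdj (coarsen L (thicken n X)) (roundShift L s c) (roundShift L s r) := by
  classical
  have hL0 : (0 : ℤ) < L := by exact_mod_cast (show 0 < L by omega)
  obtain ⟨m, hm, ε, i, hi, hcr⟩ := h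
  have aux : ∀ {c r : Fin ν → ℤ}, c = m + cornerVec ε → r = m + cornerVec (insert i ε) →
      roundShift L s c = roundShift L s r ∨
        EdgeAdj (coarsen L (thicken n X)) (roundShift L s c) (roundShift L s r) := by
    intro c r hc hr
    have hrc : r = c + Pi.single i 1 := by rw [hr, hc, cornerVec_insert hi, add_assoc]
    have hj : ∀ j, j ≠ i → roundShift L s r j = roundShift L s c j := by
      intro j hji
      simp only [roundShift, blockOf, hrc, Pi.add_apply, Pi.single_apply, if_neg hji, add_zero]
    have hii : roundShift L s r i = roundShift L s c i ∨ roundShift L s r i = roundShift L s c i + 1 := by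
      have e1 : roundShift L s r i = (c i + s i + 1) / (L : ℤ) := by
        simp only [roundShift, blockOf, hrc, Pi.add_apply, Pi.single_eq_same]
        congr 1; ring
      have e2 : roundShift L s c i = (c i + s i) / (L : ℤ) := rfl
      rcases ediv_add_one_cases hL0 (c i + s i) with ⟨h1, -⟩ | ⟨h1, -⟩
      · exact Or.inl (by rw [e1, e2, h1])
      · exact Or.inr (by rw [e1, e2, h1])
    rcases hii with hii | hii
    · left
      funext j
      by_cases hji : j = i
      · subst hji; exact hii.symm
      · exact (hj j hji).symm
    · right
      have htt : roundShift L s r = roundShift L s c + Pi.single i 1 := by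
        funext j
        by_cases hji : j = i
        · subst hji; simp [hii]
        · simp [hji, hj j hji]
      have hβ : blockOf L (m + 0) ∈ coarsen L (thicken n X) :=
        blockOf_mem_coarsen (add_mem_thicken hm (zero_mem_offsets ν n))
      obtain ⟨ε₁, h1⟩ := isCorner_blockOf_roundShift hL hs (m := m) (p := c) (δ := 0) ⟨ε, hc⟩ (zero_mem_offsets ν n)
      obtain ⟨ε₂, h2⟩ :=
        isCorner_blockOf_roundShift hL hs (m := m) (p := r) (δ := 0) ⟨insert i ε, hr⟩ (zero_mem_offsets ν n)
      have hiε : i ∉ ε₁ := by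
        intro hmem
        have a1 := congrFun h1 i
        have a2 := congrFun h2 i
        have a3 := congrFun htt i
        have c1 : (cornerVec ε₁ : Fin ν → ℤ) i = 1 := by simp [cornerVec, hmem]
        have c2 : (cornerVec ε₂ : Fin ν → ℤ) i ≤ 1 := by
          simp only [cornerVec]; split_ifs <;> simp
        simp only [Pi.add_apply, Pi.single_eq_same] at a1 a2 a3
        omega
      refine ⟨blockOf L (m + 0), hβ, ε₁, i, hiε, Or.inl ⟨h1, ?_⟩⟩
      rw [cornerVec_insert hiε, ← add_assoc, ← h1, htt]
  rcases hcr with ⟨hc, hr⟩ | ⟨hr, hc⟩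
  · exact aux hc hr
  · rcases aux hr hc with h | h
    · exact Or.inl h.symm
    · exact Or.inr (Std.Symm.symm _ _ h)

/-- **A SHIFTED ROUNDING OF A SKELETON OF `X` IS A SKELETON OF THE BLOCK FAMILY OF `X̃ⁿ`** (admissible shift, `L ≥ 2n+1`):
connected through block edges (`roundShift_edgeAdj`, `isConn_image`) and meeting every block at a corner
(`isCorner_blockOf_roundShift`).  In particular the block family of the thickening of a family with a skeleton has a
skeleton. [folklore] -/
theorem isSkeleton_image_roundShift {X S : Finset (Fin ν → ℤ)} {L n : ℕ} (hL : 2 * n + 1 ≤ L) {s : Fin ν → ℤ}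
    (hs : s ∈ shifts ν L n) (hS : IsSkeleton X S) :
    IsSkeleton (coarsen L (thicken n X)) (S.image (roundShift L s)) := by
  classical
  obtain ⟨⟨a, ha, hconn⟩, hcov⟩ := hS
  refine ⟨⟨roundShift L s a, Finset.mem_image_of_mem _ ha,
    isConn_image _ (fun x _ y _ hxy => roundShift_edgeAdj hL hs hxy) hconn⟩, ?_⟩
  intro β hβ
  obtain ⟨y, hy, rfl⟩ := Finset.mem_image.1 hβ
  obtain ⟨c, hc, δ, hδ, rfl⟩ := mem_thicken.1 hy
  obtain ⟨p, hp, hcp⟩ := hcov c hc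
  exact ⟨roundShift L s p, Finset.mem_image_of_mem _ hp, isCorner_blockOf_roundShift hL hs hcp hδ⟩

/-- the block family of the thickening of a family with a skeleton has a skeleton. [folklore] -/
theorem exists_isSkeleton_coarsen_thicken {X : Finset (Fin ν → ℤ)} {L n : ℕ} (hL : 2 * n + 1 ≤ L)
    (hX : ∃ S, IsSkeleton X S) : ∃ S', IsSkeleton (coarsen L (thicken n X)) S' := by
  obtain ⟨S, hS⟩ := hX
  obtain ⟨s, hs⟩ := shifts_nonempty (ν := ν) hL
  exact ⟨_, isSkeleton_image_roundShift hL hs hS⟩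

/-- **FEW SHIFTS SEE A GIVEN LATTICE STEP.**  Along the unit step `c → c + e_i` the shifted roundings differ only if
`L ∣ c_i + s_i + 1`, which pins `s_i` to ONE value of `[n, L−1−n]`; inserting the `L − 2n` possible values of the `i`-th
coordinate injectively, `(L − 2n) · #{s | roundings differ} ≤ #shifts`. [folklore] -/
theorem mul_card_filter_roundShift_ne_le {L n : ℕ} (hL : 2 * n + 1 ≤ L) (c : Fin ν → ℤ) (i : Fin ν) :
    (L - 2 * n) * ((shifts ν L n).filter fun s => roundShift L s c ≠ roundShift L s (c + Pi.single i 1)).card ≤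
      (shifts ν L n).card := by
  classical
  have hL0 : (0 : ℤ) < L := by exact_mod_cast (show 0 < L by omega)
  set v : ℤ := (-(c i + 1)) % (L : ℤ) with hv
  set A := (shifts ν L n).filter fun s => roundShift L s c ≠ roundShift L s (c + Pi.single i 1) with hA
  set I := Finset.Icc (n : ℤ) ((L : ℤ) - 1 - n) with hI
  have hAv : ∀ s ∈ A, s i = v := by
    intro s hsA
    obtain ⟨hs, hne⟩ := Finset.mem_filter.1 hsA
    have hs' := mem_shifts.1 hs
    have hdiff : (c i + s i + 1) / (L : ℤ) ≠ (c i + s i) / (L : ℤ) := by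
      intro heq
      apply hne
      funext j
      simp only [roundShift, blockOf, Pi.add_apply, Pi.single_apply]
      split_ifs with hji
      · subst hji
        rw [show c j + 1 + s j = c j + s j + 1 by ring, heq]
      · rw [add_zero]
    rcases ediv_add_one_cases hL0 (c i + s i) with ⟨h1, -⟩ | ⟨-, hdvd⟩
    · exact (hdiff h1).elim
    · obtain ⟨hlo, hhi⟩ := hs' i
      have hsi : s i % (L : ℤ) = s i := Int.emod_eq_of_lt (by omega) (by omega)
      have hmod : Int.ModEq (L : ℤ) (s i) (-(c i + 1)) := by
        refine Int.modEq_iff_dvd.2 ?_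
        rw [show -(c i + 1) - s i = -(c i + s i + 1) by ring]
        exact (dvd_neg).2 hdvd
      rw [← hsi]
      exact hmod
  have hmap : Set.MapsTo (fun q : (Fin ν → ℤ) × ℤ => Function.update q.1 i q.2)
      ↑(A ×ˢ I) ↑(shifts ν L n) := by
    intro q hq
    rw [Finset.mem_coe, Finset.mem_product] at hq
    obtain ⟨hqA, hqI⟩ := hq
    have hs := mem_shifts.1 (Finset.mem_filter.1 hqA).1
    rw [Finset.mem_coe, mem_shifts]
    intro j
    dsimp only
    by_cases hji : j = i
    · subst hji
      rw [Function.update_self]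
      exact Finset.mem_Icc.1 hqI
    · rw [Function.update_of_ne hji]
      exact hs j
  have hinj : Set.InjOn (fun q : (Fin ν → ℤ) × ℤ => Function.update q.1 i q.2) ↑(A ×ˢ I) := by
    intro q hq q' hq' heq
    rw [Finset.mem_coe, Finset.mem_product] at hq hq'
    have h2 : q.2 = q'.2 := by
      have := congrFun heq i
      simpa using this
    have h1 : q.1 = q'.1 := by
      funext j
      by_cases hji : j = i
      · subst hji; rw [hAv _ hq.1, hAv _ hq'.1]
      · have := congrFun heq j
        simpa [Function.update_of_ne hji] using this
    exact Prod.ext h1 h2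
  have hcard := Finset.card_le_card_of_injOn _ hmap hinj
  rw [Finset.card_product] at hcard
  have hI' : I.card = L - 2 * n := by
    rw [hI, Int.card_Icc, show ((L : ℤ) - 1 - n + 1 - n) = ((L - 2 * n : ℕ) : ℤ) by
      push_cast [Nat.cast_sub (by omega : 2 * n ≤ L)]; ring, Int.toNat_natCast]
  calc (L - 2 * n) * A.card = A.card * I.card := by rw [hI', mul_comm]
    _ ≤ (shifts ν L n).card := hcard

/-- the same along any cube edge `[c, r]` (`r = c ± e_i`). [folklore] -/
theorem mul_card_filter_le_of_edgeAdj {X : Finset (Fin ν → ℤ)} {L n : ℕ} (hL : 2 * n + 1 ≤ L) {c r : Fin ν → ℤ}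
    (h : EdgeAdj X c r) :
    (L - 2 * n) * ((shifts ν L n).filter fun s => roundShift L s c ≠ roundShift L s r).card ≤ (shifts ν L n).card := by
  classical
  obtain ⟨i, hi⟩ := exists_single_of_edgeAdj h
  rcases hi with rfl | rfl
  · exact mul_card_filter_roundShift_ne_le hL c i
  · have : ((shifts ν L n).filter fun s => roundShift L s (r + Pi.single i 1) ≠ roundShift L s r) =
        ((shifts ν L n).filter fun s => roundShift L s r ≠ roundShift L s (r + Pi.single i 1)) :=
      Finset.filter_congr fun s _ => ne_comm
    rw [this]
    exact mul_card_filter_roundShift_ne_le hL r i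

end Rounding

/-! ## §4 THE RESCALING INEQUALITY: `(L − 2n)·d(blocks of X̃ⁿ) ≤ d(X)`; [II] (2.36) for every `L ≥ 4` -/

section Rescaling

variable {ν : ℕ}

/-- **THE RESCALING INEQUALITY (kernel; sharper than print).**  For every cube family `X ⊆ ℤ^ν` with a skeleton (e.g.
wall-connected), every thickening radius `n` and every block size `L ≥ 2n + 1`:
`(L − 2n) · d(block family of X̃ⁿ) ≤ d(X)` — linear sizes in the lattice-edge form of [I] p.257, the block family measured
one scale up.  PROOF: an optimal skeleton `S` of `X` (`#S = d(X)+1`); every shifted rounding `⌊(S+s)/L⌋`,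
`s ∈ [n, L−1−n]^ν`, is a skeleton of the block family (`isSkeleton_image_roundShift`), so `d(blocks) ≤ #⌊(S+s)/L⌋ − 1`;
and ON AVERAGE over the `(L−2n)^ν` shifts the rounding has at most `1 + (#S−1)/(L−2n)` points, because a cube edge of a
spanning structure of `S` is seen (its endpoints rounded differently) by at most a `1/(L−2n)` fraction of the shifts
(`mul_card_filter_le_of_edgeAdj`, `exists_mul_card_image_sub_one_le`).  [II] p.19 proves the case `n = 1` with constant
`2/L` instead of `1/(L−2)`: «2d_k(Z_i) ≥ Ld_{k+1}(Z′_i). (2.36) This inequality can be obtained by simple, but awkward,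
geometric and combinatoric considerations. It follows by considering locally many possible cases.»
[cite: Balaban1988RG2Cluster, (2.36) p.19] -/
theorem sub_mul_linSize_coarsen_thicken_le {X : Finset (Fin ν → ℤ)} (hX : ∃ S, IsSkeleton X S) {L n : ℕ}
    (hL : 2 * n + 1 ≤ L) : (L - 2 * n) * linSize (coarsen L (thicken n X)) ≤ linSize X := by
  classical
  obtain ⟨S, hS, hcard⟩ := exists_isSkeleton_card_eq hX
  obtain ⟨a, ha, hconn⟩ := hS.1
  obtain ⟨s, hs, hle⟩ := exists_mul_card_image_sub_one_le (shifts ν L n) (shifts_nonempty hL)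
    (fun s p => roundShift L s p) (fun c r hcr => mul_card_filter_le_of_edgeAdj hL hcr) S a hconn
  have h1 := linSize_le_card_sub_one_of_isSkeleton (isSkeleton_image_roundShift hL hs hS)
  calc (L - 2 * n) * linSize (coarsen L (thicken n X)) ≤ (L - 2 * n) * ((S.image (roundShift L s)).card - 1) :=
        Nat.mul_le_mul_left _ h1
    _ ≤ S.card - 1 := hle
    _ = linSize X := by omega

/-- **NO THICKENING (`n = 0`): `L · d(blocks of X) ≤ d(X)`** — coarse-graining a cube family by blocks of side `L` divides
its linear size by at least `L`. [folklore] -/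
theorem mul_linSize_coarsen_le {X : Finset (Fin ν → ℤ)} (hX : ∃ S, IsSkeleton X S) {L : ℕ} (hL : 1 ≤ L) :
    L * linSize (coarsen L (thicken 0 X)) ≤ linSize X := by
  simpa using sub_mul_linSize_coarsen_thicken_le hX (n := 0) (L := L) (by omega)

/-- **[II] (2.36) AS PRINTED, `2·d_k(Z) ≥ L·d_{k+1}(Z′)`, FOR EVERY `L ≥ 4`** (hence for every «odd, positive integer
> 11», [I] p.251), for every cube family `Z ⊆ ℤ^ν` with a skeleton, `Z′` = the block family of `Z̃ = Z̃¹`: from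
`(L−2)·d′ ≤ d` and `2d′ ≤ (L−2)d′`.  [II] p.19, verbatim: «The set Z₀ determining it is a union of connected components,
Z₀ = ∪Z_i, and we denote by Z′_i the smallest localization domain from 𝐃_{k+1} containing Z̃_i.» … «We extract
exp(−δκd_k(Z_i)) from each exponential in (2.35), corresponding to one of these components. The remaining exponential is
bounded using the following inequality: 2d_k(Z_i) ≥ Ld_{k+1}(Z′_i). (2.36)»  (For `L = 3` the printed form fails:
`not_printedIneq236_three`.) [cite: Balaban1988RG2Cluster, (2.36) p.19] -/
theorem printed236_of_four_le {Z : Finset (Fin ν → ℤ)} (hZ : ∃ S, IsSkeleton Z S) {L : ℕ} (hL : 4 ≤ L) :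
    L * linSize (coarsen L (thicken 1 Z)) ≤ 2 * linSize Z := by
  have h1 := sub_mul_linSize_coarsen_thicken_le hZ (n := 1) (L := L) (by omega)
  set d' := linSize (coarsen L (thicken 1 Z))
  set d := linSize Z
  have h2 : 2 * d' ≤ (L - 2 * 1) * d' := Nat.mul_le_mul_right d' (by omega)
  have h3 : L * d' = (L - 2 * 1) * d' + 2 * d' := by
    rw [← Nat.add_mul, Nat.sub_add_cancel (by omega : 2 * 1 ≤ L)]
  calc L * d' = (L - 2 * 1) * d' + 2 * d' := h3
    _ ≤ d + (L - 2 * 1) * d' := Nat.add_le_add h1 h2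
    _ ≤ d + d := Nat.add_le_add_left h1 d
    _ = 2 * d := (two_mul d).symm

/-- [II] (2.36) in print's standing range [I] p.251 «where L is an odd, positive integer > 11». [cite: Balaban1988RG2Cluster, (2.36) p.19] -/
theorem printed236_of_eleven_lt {Z : Finset (Fin ν → ℤ)} (hZ : ∃ S, IsSkeleton Z S) {L : ℕ} (hL : 11 < L) :
    L * linSize (coarsen L (thicken 1 Z)) ≤ 2 * linSize Z :=
  printed236_of_four_le hZ (by omega)

/-- **SMALL DOMAINS DO NOT PROPAGATE: `d(X) < L − 2n ⟹ d(blocks of X̃ⁿ) = 0`** (all blocks meeting `X̃ⁿ` have a common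
corner). [folklore] -/
theorem linSize_coarsen_thicken_eq_zero {X : Finset (Fin ν → ℤ)} (hX : ∃ S, IsSkeleton X S) {L n : ℕ}
    (hL : 2 * n + 1 ≤ L) (hd : linSize X < L - 2 * n) : linSize (coarsen L (thicken n X)) = 0 := by
  have h1 := sub_mul_linSize_coarsen_thicken_le hX hL
  by_contra h0
  have h2 : L - 2 * n ≤ (L - 2 * n) * linSize (coarsen L (thicken n X)) :=
    Nat.le_mul_of_pos_right _ (Nat.pos_of_ne_zero h0)
  omega

/-- **THE PER-STEP FADING-MEMORY FACTOR (exponential form of the rescaling inequality).**  For `0 ≤ a`: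
`exp(−a·d_k(Z)) ≤ exp(−a(L−2n)·d_{k+1}(Z′))` — a decay rate `a` in the scale-`k` linear size of `Z` is a decay rate
`a(L−2n)` in the scale-`(k+1)` linear size of the block family of `Z̃ⁿ`; with `n = 1` this is the step from (2.35) to
(2.37) p.19–20: p.19 «The remaining exponential is bounded using the following inequality: 2d_k(Z_i) ≥ Ld_{k+1}(Z′_i).
(2.36)» — «remaining» = after the extraction of `exp(−δκd_k(Z_i))` for the component sum, so print applies (2.36) with
`a = (1 − 6δ)κ`, p.20 «and (1 − 5δ)κd_k(Z_i) in the exponentials replaced by (1 − 6δ)½Lκd_{k+1}(Z′_i)»: rate `a ↦ ½La`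
(print) ∕ `a ↦ a(L−2) ≥ ½La` (kernel, `L ≥ 4`). [cite: Balaban1988RG2Cluster, (2.36)–(2.37) pp.19–20] -/
theorem exp_neg_mul_linSize_le_exp_coarsen {X : Finset (Fin ν → ℤ)} (hX : ∃ S, IsSkeleton X S) {L n : ℕ}
    (hL : 2 * n + 1 ≤ L) {a : ℝ} (ha : 0 ≤ a) :
    Real.exp (-a * (linSize X : ℝ)) ≤
      Real.exp (-(a * ((L : ℝ) - 2 * n)) * (linSize (coarsen L (thicken n X)) : ℝ)) := by
  have h1 := sub_mul_linSize_coarsen_thicken_le hX hL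
  have h2 : ((L - 2 * n : ℕ) : ℝ) * (linSize (coarsen L (thicken n X)) : ℝ) ≤ (linSize X : ℝ) := by
    exact_mod_cast h1
  have h3 : ((L - 2 * n : ℕ) : ℝ) = (L : ℝ) - 2 * n := by
    rw [Nat.cast_sub (by omega : 2 * n ≤ L)]; push_cast; ring
  rw [h3] at h2
  apply Real.exp_le_exp.2
  nlinarith

/-- the printed rate: `exp(−a·d_k(Z)) ≤ exp(−(aL/2)·d_{k+1}(Z′))` for `L ≥ 4`, `0 ≤ a` ((2.35) → (2.37) with (2.36)).
[cite: Balaban1988RG2Cluster, (2.36)–(2.37) pp.19–20] -/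
theorem exp_neg_mul_linSize_le_exp_half {Z : Finset (Fin ν → ℤ)} (hZ : ∃ S, IsSkeleton Z S) {L : ℕ} (hL : 4 ≤ L)
    {a : ℝ} (ha : 0 ≤ a) :
    Real.exp (-a * (linSize Z : ℝ)) ≤ Real.exp (-(a * (L : ℝ) / 2) * (linSize (coarsen L (thicken 1 Z)) : ℝ)) := by
  have h1 := printed236_of_four_le hZ hL
  have h2 : (L : ℝ) * (linSize (coarsen L (thicken 1 Z)) : ℝ) ≤ 2 * (linSize Z : ℝ) := by exact_mod_cast h1
  apply Real.exp_le_exp.2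
  nlinarith

end Rescaling

/-! ## §5 The boundary value `L = 3`: the printed (2.36) fails (three aligned cubes); the sharper inequality is attained -/

section Three

/-- three aligned unit cubes of `ℤ⁴`: `0, e₀, 2e₀` — a wall-connected domain of linear size `1`. [folklore] -/
def line3 : Finset (Fin 4 → ℤ) := {0, ue 0, ue 0 + ue 0}

/-- `{e₀, 2e₀}` is a skeleton of the three aligned cubes (the edge `[e₀, 2e₀]` of the middle cube; `e₀` is a corner of
the cubes `0` and `e₀`, `2e₀` of the cube `2e₀`). [folklore] -/
theorem isSkeleton_line3 : IsSkeleton line3 ({ue 0, ue 0 + ue 0} : Finset (Fin 4 → ℤ)) := by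
  classical
  refine ⟨⟨ue 0, Finset.mem_insert_self _ _, isConn_pair_of_adj ?_⟩, ?_⟩
  · refine ⟨ue 0, by simp [line3], ∅, 0, Finset.notMem_empty _, Or.inl ⟨by simp, ?_⟩⟩
    rw [Finset.insert_empty, cornerVec_singleton]; rfl
  · intro m hm
    simp only [line3, Finset.mem_insert, Finset.mem_singleton] at hm
    rcases hm with rfl | rfl | rfl
    · exact ⟨ue 0, Finset.mem_insert_self _ _, ⟨{0}, by rw [cornerVec_singleton, zero_add]; rfl⟩⟩
    · exact ⟨ue 0, Finset.mem_insert_self _ _, isCorner_self _⟩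
    · exact ⟨ue 0 + ue 0, Finset.mem_insert_of_mem (Finset.mem_singleton_self _), isCorner_self _⟩

/-- `d(line3) ≤ 1`. [folklore] -/
theorem linSize_line3_le_one : linSize line3 ≤ 1 := by
  have h := linSize_le_card_sub_one_of_isSkeleton isSkeleton_line3
  have hc : ({ue 0, ue 0 + ue 0} : Finset (Fin 4 → ℤ)).card ≤ 2 := Finset.card_insert_le _ _
  omega

/-- **the block family of `line3~` for `L = 3` has linear size `≥ 1`**: it contains the blocks of index `−e₀` (from the
cube `−e₀ ∈ □̃(0)`) and `+e₀` (from `3e₀ ∈ □̃(2e₀)`), whose corners have `0`-th coordinates in `{−1, 0}` and `{1, 2}`: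
no common corner, so every skeleton has two points. [folklore] -/
theorem one_le_linSize_coarsen_line3 : 1 ≤ linSize (coarsen 3 (thicken 1 line3)) := by
  classical
  have hex : ∃ S, IsSkeleton line3 S := ⟨_, isSkeleton_line3⟩
  refine le_linSize (exists_isSkeleton_coarsen_thicken (n := 1) (L := 3) (by norm_num) hex) fun T hT => ?_
  have hneg : -ue 0 ∈ offsets 4 1 := mem_offsets.2 fun i => by
    fin_cases i <;> simp [ue]
  have hpos : ue 0 ∈ offsets 4 1 := mem_offsets.2 fun i => by
    fin_cases i <;> simp [ue]
  have hb1 : blockOf 3 ((0 : Fin 4 → ℤ) + -ue 0) ∈ coarsen 3 (thicken 1 line3) :=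
    blockOf_mem_coarsen (add_mem_thicken (by simp [line3]) hneg)
  have hb2 : blockOf 3 ((ue 0 + ue 0) + ue 0) ∈ coarsen 3 (thicken 1 line3) :=
    blockOf_mem_coarsen (add_mem_thicken (by simp [line3]) hpos)
  obtain ⟨q₁, hq₁, ε₁, h₁⟩ := hT.2 _ hb1
  obtain ⟨q₂, hq₂, ε₂, h₂⟩ := hT.2 _ hb2
  have e1 : blockOf 3 ((0 : Fin 4 → ℤ) + -ue 0) 0 = -1 := by simp [blockOf, ue]
  have e2 : blockOf 3 ((ue 0 + ue 0) + ue 0) 0 = 1 := by simp [blockOf, ue]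
  have c1 : (cornerVec ε₁ : Fin 4 → ℤ) 0 ≤ 1 ∧ 0 ≤ (cornerVec ε₁ : Fin 4 → ℤ) 0 := by
    simp only [cornerVec]; split_ifs <;> simp
  have c2 : (cornerVec ε₂ : Fin 4 → ℤ) 0 ≤ 1 ∧ 0 ≤ (cornerVec ε₂ : Fin 4 → ℤ) 0 := by
    simp only [cornerVec]; split_ifs <;> simp
  have a1 := congrFun h₁ 0
  have a2 := congrFun h₂ 0
  rw [Pi.add_apply, e1] at a1
  rw [Pi.add_apply, e2] at a2
  have hne : q₁ ≠ q₂ := by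
    intro h; rw [h] at a1; omega
  exact Finset.one_lt_card.2 ⟨q₁, hq₁, q₂, hq₂, hne⟩

/-- **[II] (2.36) FAILS AT `L = 3`**: for the three aligned cubes, `2·d_k = 2 < 3 = L·d_{k+1}(Z′)`.  (`L = 3` is outside
print's standing assumption [I] p.251 «L is an odd, positive integer > 11»; the example marks the boundary of the range
`L ≥ 4` of `printed236_of_four_le`.) [cite: Balaban1988RG2Cluster, (2.36) p.19] -/
theorem not_printedIneq236_three : ¬ (3 * linSize (coarsen 3 (thicken 1 line3)) ≤ 2 * linSize line3) := by
  have h1 := one_le_linSize_coarsen_line3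
  have h2 := linSize_line3_le_one
  omega

/-- at `L = 3` the sharper inequality `(L−2)·d′ ≤ d` is an EQUALITY for the three aligned cubes: `d = d′ = 1`. [folklore] -/
theorem linSize_line3_and_coarsen : linSize line3 = 1 ∧ linSize (coarsen 3 (thicken 1 line3)) = 1 := by
  have h1 := one_le_linSize_coarsen_line3
  have h2 := linSize_line3_le_one
  have h3 := sub_mul_linSize_coarsen_thicken_le (X := line3) ⟨_, isSkeleton_line3⟩ (n := 1) (L := 3) (by norm_num)
  norm_num at h3
  omega

/-- **THE PRINTED (2.36) AS A STATEMENT ABOUT A BLOCK SIZE `L`** (all cube families of `ℤ^ν` with a skeleton, `Z̃ = Z̃¹`,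
lattice-edge linear sizes). [cite: Balaban1988RG2Cluster, (2.36) p.19] -/
def PrintedIneq236 (ν L : ℕ) : Prop :=
  ∀ Z : Finset (Fin ν → ℤ), (∃ S, IsSkeleton Z S) → L * linSize (coarsen L (thicken 1 Z)) ≤ 2 * linSize Z

/-- (2.36) holds for every `L ≥ 4` in every dimension. [cite: Balaban1988RG2Cluster, (2.36) p.19] -/
theorem printedIneq236_of_four_le {ν L : ℕ} (hL : 4 ≤ L) : PrintedIneq236 ν L :=
  fun _ hZ => printed236_of_four_le hZ hL

/-- (2.36) fails for `L = 3` on `ℤ⁴`. [cite: Balaban1988RG2Cluster, (2.36) p.19] -/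
theorem not_printedIneq236_four_three : ¬ PrintedIneq236 4 3 :=
  fun h => not_printedIneq236_three (h line3 ⟨_, isSkeleton_line3⟩)

end Three

/-! ## §6 Thickenings and block families of wall-connected families are wall-connected (so `Z′ =` the block family) -/

section Connectivity

variable {ν : ℕ}

/-- every cube of `□̃ⁿ` is reached from `□` through walls inside `X̃ⁿ` (one unit step at a time towards `□`). [folklore] -/
theorem reach_add_of_mem_offsets {n : ℕ} {X : Finset (Fin ν → ℤ)} {c : Fin ν → ℤ} (hc : c ∈ X) {δ : Fin ν → ℤ}
    (hδ : δ ∈ offsets ν n) : Polymer.Reach WallAdj (thicken n X) c (c + δ) := by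
  classical
  suffices h : ∀ k : ℕ, ∀ δ : Fin ν → ℤ, δ ∈ offsets ν n → (∑ j, (δ j).natAbs) = k →
      Polymer.Reach WallAdj (thicken n X) c (c + δ) from h _ δ hδ rfl
  intro k
  induction k with
  | zero =>
    intro δ hδ hsum
    have h0 : δ = 0 := by
      funext j
      have := (Finset.sum_eq_zero_iff.1 hsum) j (Finset.mem_univ j)
      simpa using this
    rw [h0, add_zero]
    exact Polymer.Reach.refl _
  | succ k ih =>
    intro δ hδ hsum
    have hδ' := mem_offsets.1 hδ
    obtain ⟨j, hj⟩ : ∃ j, δ j ≠ 0 := by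
      by_contra hall
      have : ∑ j, (δ j).natAbs = 0 := Finset.sum_eq_zero fun j _ => by
        simpa using (not_exists.1 hall) j
      omega
    set δ' : Fin ν → ℤ := if δ j < 0 then δ + Pi.single j 1 else δ - Pi.single j 1 with hδ'def
    have hjj : (δ' j).natAbs + 1 = (δ j).natAbs ∧ (-(n : ℤ) ≤ δ' j ∧ δ' j ≤ n) := by
      obtain ⟨h1, h2⟩ := hδ' j
      rw [hδ'def]
      split_ifs with hneg
      · simp only [Pi.add_apply, Pi.single_eq_same]; omega
      · simp only [Pi.sub_apply, Pi.single_eq_same]; omega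
    have hother : ∀ l, l ≠ j → δ' l = δ l := fun l hl => by
      rw [hδ'def]; split_ifs <;> simp [hl]
    have hδ'mem : δ' ∈ offsets ν n := mem_offsets.2 fun l => by
      by_cases hl : l = j
      · subst hl; exact hjj.2
      · rw [hother l hl]; exact hδ' l
    have hsum' : ∑ l, (δ' l).natAbs = k := by
      have e1 := Finset.add_sum_erase Finset.univ (fun l => (δ l).natAbs) (Finset.mem_univ j)
      have e2 := Finset.add_sum_erase Finset.univ (fun l => (δ' l).natAbs) (Finset.mem_univ j)
      have e3 : ∑ l ∈ Finset.univ.erase j, (δ' l).natAbs = ∑ l ∈ Finset.univ.erase j, (δ l).natAbs :=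
        Finset.sum_congr rfl fun l hl => by rw [hother l (Finset.ne_of_mem_erase hl)]
      have e4 := hjj.1
      omega
    refine (ih δ' hδ'mem hsum').tail (add_mem_thicken hc hδ'mem) (add_mem_thicken hc hδ) ⟨j, ?_⟩
    by_cases hneg : δ j < 0
    · right
      rw [hδ'def, if_pos hneg]; abel
    · left
      rw [hδ'def, if_neg hneg]; abel

/-- **`X̃ⁿ` IS WALL-CONNECTED** when `X` is (rooted at the same cube). [folklore] -/
theorem isConn_thicken {n : ℕ} {X : Finset (Fin ν → ℤ)} {a : Fin ν → ℤ} (h : Polymer.IsConn WallAdj X a) :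
    Polymer.IsConn WallAdj (thicken n X) a := by
  refine ⟨self_mem_thicken h.1, fun y hy => ?_⟩
  obtain ⟨c, hc, δ, hδ, rfl⟩ := mem_thicken.1 hy
  exact ((h.2 c hc).mono fun x hx => self_mem_thicken hx).trans (reach_add_of_mem_offsets hc hδ)

/-- the blocks of two wall-adjacent cubes coincide or are wall-adjacent (`1 ≤ L`). [folklore] -/
theorem blockOf_eq_or_wallAdj {L : ℕ} (hL : 1 ≤ L) {c c' : Fin ν → ℤ} (h : WallAdj c c') :
    blockOf L c = blockOf L c' ∨ WallAdj (blockOf L c) (blockOf L c') := by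
  have hL0 : (0 : ℤ) < L := by exact_mod_cast hL
  obtain ⟨i, h⟩ := h
  have aux : ∀ {x y : Fin ν → ℤ}, y = x + Pi.single i 1 →
      blockOf L x = blockOf L y ∨ WallAdj (blockOf L x) (blockOf L y) := by
    intro x y hy
    have hj : ∀ j, j ≠ i → blockOf L y j = blockOf L x j := fun j hj => by
      simp [blockOf, hy, hj]
    rcases ediv_add_one_cases hL0 (x i) with ⟨h1, -⟩ | ⟨h1, -⟩
    · left
      funext j
      by_cases hji : j = i
      · subst hji
        simp only [blockOf, hy, Pi.add_apply, Pi.single_eq_same]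
        exact h1.symm
      · exact (hj j hji).symm
    · right
      refine ⟨i, Or.inl ?_⟩
      funext j
      by_cases hji : j = i
      · subst hji
        simp only [blockOf, hy, Pi.add_apply, Pi.single_eq_same]
        exact h1
      · simp [hji, hj j hji]
  rcases h with h | h
  · exact aux h
  · have h' : c = c' + Pi.single i 1 := by rw [h]; simp
    rcases aux h' with h1 | h1
    · exact Or.inl h1.symm
    · exact Or.inr (Std.Symm.symm _ _ h1)

/-- **THE BLOCK FAMILY OF A WALL-CONNECTED FAMILY IS WALL-CONNECTED** (one scale up). [folklore] -/
theorem isConn_coarsen {L : ℕ} (hL : 1 ≤ L) {Y : Finset (Fin ν → ℤ)} {a : Fin ν → ℤ}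
    (h : Polymer.IsConn WallAdj Y a) : Polymer.IsConn WallAdj (coarsen L Y) (blockOf L a) := by
  classical
  exact isConn_image _ (fun x _ y _ hxy => blockOf_eq_or_wallAdj hL hxy) h

/-- **`Z′` IS A DOMAIN**: for a wall-connected `Z`, the block family of `Z̃ⁿ` is wall-connected — so (the lattice of
`M`-cubes refining that of `LM`-cubes, [I] p.251) it IS «the smallest localization domain from 𝐃_{k+1} containing Z̃_i»
of [II] p.19 (print's `Z′_i`, for the component `Z_i = Z`), read as a cube family one scale up. [cite: Balaban1988RG2Cluster, p.19] -/
theorem isConn_coarsen_thicken {L n : ℕ} (hL : 1 ≤ L) {X : Finset (Fin ν → ℤ)} {a : Fin ν → ℤ}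
    (h : Polymer.IsConn WallAdj X a) : Polymer.IsConn WallAdj (coarsen L (thicken n X)) (blockOf L a) :=
  isConn_coarsen hL (isConn_thicken h)

/-- **(2.36) FOR DOMAINS**: for a wall-connected `Z ⊆ ℤ^ν` (a localization domain read as its family of cubes) and
`L ≥ 4`, `L·d(Z′) ≤ 2·d(Z)` with `Z′` the (wall-connected) block family of `Z̃`. [cite: Balaban1988RG2Cluster, (2.36) p.19] -/
theorem printed236_of_isConn {Z : Finset (Fin ν → ℤ)} {a : Fin ν → ℤ} (hZ : Polymer.IsConn WallAdj Z a) {L : ℕ}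
    (hL : 4 ≤ L) : L * linSize (coarsen L (thicken 1 Z)) ≤ 2 * linSize Z :=
  printed236_of_four_le ⟨Z, isSkeleton_self_of_isConn hZ⟩ hL

end Connectivity

end Literature.MathematicalPhysics.QuantumFieldTheory.Balaban1983to89.T4HistoryLipschitzRescaling

end
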